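import Summits.ResolutionOfSingularities.ResolutionOfSingularities.Theorems.PurelyInseparableDim4TschirnhausClean
import HarnessLib
import HarnessLib.Audit.Tags

/-!
# Purely inseparable four-folds — the LINEAR STRAIGHTENING of a power cone: the W-frame move that turns
# `a₀·ℓ^d` into `c·x_f^d` (cell `res-dim4-pi`, K2(p) lane, brick (ii) «Tschirnhaus / W-frame infrastructure»,
# the producer of FILE D's entry hypothesis)

[OURS · counted 0 · cell `res-dim4-pi` · brick (ii), seat res-dim4-p-11 g3 (offer 2026-08-29T01:09Z).]  Nothing here
proves K2(p), `NoIsolatedTrap p p` or resolution of singularities in dimension ≥ 4 / characteristic `p`.  AI kernel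
work, weaker than expert review.

On a slice-B state the residual cone is a POWER CONE `resForm s = a₀·(Σ ℓᵢ xᵢ)^d` (`…ResConePowerCone`), and the
Tschirnhaus files start from `in_d G = c·x_f^d` (FILE D `exists_tschirnhaus_jet_of_initialForm`, FILE C
`exists_tsch_jet_state`, D3).  The join is the linear move of FILE B1/B3 with the datum
`φ_ℓ := −Σ_{i ≠ f} (ℓᵢ/ℓ_f)·xᵢ` for a letter `f` with `ℓ_f ≠ 0` (idea-4 I-4-7 (TS)(i): `v̄ = ℓ/ℓ_f + O(2)`):

* §1 `tsch_linearForm` — `tsch f φ_c (Σ ℓᵢ xᵢ) = Σ ℓᵢ xᵢ + ℓ_f·φ_c` for every linear datum `φ_c`;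
  **`tsch_linearForm_straighten`** — with `φ_ℓ`: `tsch f φ_ℓ (Σ ℓᵢ xᵢ) = ℓ_f·x_f`; **`tsch_powerCone_straighten`** —
  `tsch f φ_ℓ (a₀·(Σ ℓᵢ xᵢ)^d) = (a₀ ℓ_f^d)·x_f^d`;
* §2 state level, IN THE BAND `p ∤ ord₀ F` (where every isolated above-floor chain lives), `f` free (`r_f = 0`),
  `x^r ∣ F`: **`resForm_cleanTschState_straighten`** — the clean re-framed presented state
  `⟨clean (tsch f φ_ℓ s.F), r, exc⟩` has residual cone `(a₀ ℓ_f^d)·x_f^d` (FILE E part 1 `resForm_cleanTschState_eq` +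
  FILE B3 `resForm_tschState_of_isHomogeneous_one` + §1); the datum `φ_ℓ` is admissible (`straighten_datum_admissible`:
  `x_f ∉ vars`, `φ_ℓ(0) = 0`, homogeneous of degree `1`), so FILE E carries isolation / order / shade / `e_G`, and FILE E
  part 2 rides it along the walk.
[cite: Kollar2007, Aside 3.57] [folklore]
bears_on: LADDER-RESOLUTION:D157-DOOR2 (res-dim4-pi · K2(p) · (ii) straightening).  Supports
stmt-ResolutionOfSingularities-16155 (helper).
-/

set_option linter.dupNamespace false -- mandated namespace of this single-conjunct summit

noncomputable section

namespace Summit.ResolutionOfSingularities.ResolutionOfSingularities.Theorems.PIDim4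

namespace FrameChange

open MvPolynomial Finset
open Literature.AlgebraicGeometry.Resolution
open Literature.AlgebraicGeometry.Resolution.Hauser2010
open Literature.AlgebraicGeometry.Resolution.HauserPerlega2019
open Literature.AlgebraicGeometry.Resolution.CentreBlowup

variable {K : Type} [Field K] {f : Fin 4}

/-! ## 1. The linear move on a linear form and on a power cone -/

/-- The move fixes constants. [folklore] -/
theorem tsch_C (φ : MvPolynomial (Fin 4) K) (a : K) : tsch f φ (C a) = C a := by
  rw [← MvPolynomial.algebraMap_eq]
  exact (tsch f φ).commutes a

/-- **A linear move on a linear form**: `tsch f φ_c (Σ ℓᵢ xᵢ) = Σ ℓᵢ xᵢ + ℓ_f · φ_c` (only `x_f` moves).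
[folklore] -/
theorem tsch_linearForm (c ℓ : Fin 4 → K) :
    tsch f (∑ i, C (c i) * X i) (∑ i, C (ℓ i) * X i) =
      (∑ i, C (ℓ i) * X i) + C (ℓ f) * ∑ i, C (c i) * X i := by
  classical
  rw [map_sum]
  have h : ∀ i, tsch f (∑ i, C (c i) * X i) (C (ℓ i) * X i) =
      C (ℓ i) * X i + (if i = f then C (ℓ f) * ∑ i, C (c i) * X i else 0) := by
    intro i
    rw [map_mul, tsch_C]
    by_cases hif : i = f
    · subst hif
      rw [tsch_X_self, if_pos rfl, mul_add]
    · rw [tsch_X_of_ne _ hif, if_neg hif, add_zero]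
  simp_rw [h]
  rw [Finset.sum_add_distrib, Finset.sum_ite_eq' Finset.univ f, if_pos (Finset.mem_univ f)]

/-- The straightening datum `φ_ℓ = −Σ_{i ≠ f} (ℓᵢ/ℓ_f) xᵢ`, as a coefficient function. (Written out inline in the
statements below: `fun i => if i = f then 0 else -(ℓ i / ℓ f)`.) [folklore] -/
theorem straighten_coeff_self (ℓ : Fin 4 → K) :
    (fun i => if i = f then (0 : K) else -(ℓ i / ℓ f)) f = 0 := if_pos rfl

/-- **STRAIGHTENING A LINEAR FORM**: for `ℓ_f ≠ 0`, `tsch f φ_ℓ (Σ ℓᵢ xᵢ) = ℓ_f · x_f`. [folklore] -/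
theorem tsch_linearForm_straighten {ℓ : Fin 4 → K} (hℓf : ℓ f ≠ 0) :
    tsch f (∑ i, C ((fun i => if i = f then (0 : K) else -(ℓ i / ℓ f)) i) * X i) (∑ i, C (ℓ i) * X i) =
      C (ℓ f) * X f := by
  classical
  rw [tsch_linearForm, Finset.mul_sum]
  -- collect: Σ_i (ℓ_i + ℓ_f c_i) x_i with ℓ_i + ℓ_f c_i = 0 for i ≠ f and = ℓ_f for i = f
  have h : ∀ i, C (ℓ i) * X i + C (ℓ f) * (C ((fun i => if i = f then (0 : K) else -(ℓ i / ℓ f)) i) * X i) =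
      (if i = f then C (ℓ f) * X f else 0 : MvPolynomial (Fin 4) K) := by
    intro i
    by_cases hif : i = f
    · subst hif
      simp only [C_0, zero_mul, mul_zero, add_zero, if_true]
    · simp only [if_neg hif]
      rw [← mul_assoc, ← C_mul, ← add_mul, ← C_add, show ℓ i + ℓ f * -(ℓ i / ℓ f) = 0 by field_simp; ring, C_0,
        zero_mul]
  rw [← Finset.sum_add_distrib]
  simp_rw [h]
  rw [Finset.sum_ite_eq' Finset.univ f, if_pos (Finset.mem_univ f)]

/-- **STRAIGHTENING A POWER CONE**: for `ℓ_f ≠ 0`, `tsch f φ_ℓ (a₀ · (Σ ℓᵢ xᵢ)^d) = (a₀ ℓ_f^d) · x_f^d`.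
[cite: Kollar2007, Aside 3.57] [folklore] -/
theorem tsch_powerCone_straighten {ℓ : Fin 4 → K} (hℓf : ℓ f ≠ 0) (a₀ : K) (d : ℕ) :
    tsch f (∑ i, C ((fun i => if i = f then (0 : K) else -(ℓ i / ℓ f)) i) * X i)
        (C a₀ * (∑ i, C (ℓ i) * X i) ^ d) = C (a₀ * ℓ f ^ d) * X f ^ d := by
  rw [map_mul, map_pow, tsch_C, tsch_linearForm_straighten hℓf, mul_pow, ← C_pow, ← mul_assoc, ← C_mul]

/-- The straightening datum is admissible: `x_f ∉ vars φ_ℓ`, `φ_ℓ(0) = 0`, homogeneous of degree `1`. [folklore] -/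
theorem straighten_datum_admissible (ℓ : Fin 4 → K) :
    f ∉ (∑ i, C ((fun i => if i = f then (0 : K) else -(ℓ i / ℓ f)) i) * X i : MvPolynomial (Fin 4) K).vars ∧
      constantCoeff (∑ i, C ((fun i => if i = f then (0 : K) else -(ℓ i / ℓ f)) i) * X i : MvPolynomial (Fin 4) K) = 0 ∧
      (∑ i, C ((fun i => if i = f then (0 : K) else -(ℓ i / ℓ f)) i) * X i : MvPolynomial (Fin 4) K).IsHomogeneous 1 :=
  ⟨not_mem_vars_linear (straighten_coeff_self ℓ),
    constantCoeff_eq_zero_of_isHomogeneous_one (isHomogeneous_linear _), isHomogeneous_linear _⟩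

/-! ## 2. State level: the residual cone of the straightened presented state -/

section State

variable (p : ℕ) [hp : Fact p.Prime] [CharP K p]

omit hp [CharP K p] in
/-- **THE STRAIGHTENED FRAME OF A POWER-CONE STATE** (in the band `p ∤ ord₀ F`, `f` free, `x^r ∣ F`): if
`resForm s = a₀ · (Σ ℓᵢ xᵢ)^d` with `ℓ_f ≠ 0`, the clean re-framed presented state `⟨clean (tsch f φ_ℓ s.F), r, exc⟩`
has residual cone `(a₀ ℓ_f^d) · x_f^d` — the entry shape `c · x_f^d` of the Tschirnhaus jet files (FILE D / C / D3).
[cite: Kollar2007, Aside 3.57] [folklore] -/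
theorem resForm_cleanTschState_straighten {s : State K} {o : ℕ} (ho : ordZero s.F = o) (hpo : ¬ p ∣ o)
    (hr0 : s.r f = 0) (hr : ∀ e ∈ s.F.support, s.r ≤ e) {a₀ : K} {ℓ : Fin 4 → K} {d : ℕ}
    (hform : ResCone.resForm s = C a₀ * (∑ i, C (ℓ i) * X i) ^ d) (hℓf : ℓ f ≠ 0) :
    ResCone.resForm (⟨deletePthPowers p (tsch f (∑ i, C ((fun i => if i = f then (0 : K) else -(ℓ i / ℓ f)) i) * X i)
        s.F), s.r, s.exc⟩ : State K) = C (a₀ * ℓ f ^ d) * X f ^ d := by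
  obtain ⟨hvars, h0, hhom⟩ := straighten_datum_admissible (f := f) ℓ
  rw [resForm_cleanTschState_eq p hvars h0 ho hpo, resForm_tschState_of_isHomogeneous_one hvars hhom hr0 hr, hform,
    tsch_powerCone_straighten hℓf]

omit hp [CharP K p] in
/-- … with a non-zero coefficient: `a₀ ℓ_f^d ≠ 0` when `a₀ ≠ 0`. [folklore] -/
theorem straighten_coeff_ne_zero {a₀ : K} (ha₀ : a₀ ≠ 0) {ℓ : Fin 4 → K} (hℓf : ℓ f ≠ 0) (d : ℕ) :
    a₀ * ℓ f ^ d ≠ 0 :=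
  mul_ne_zero ha₀ (pow_ne_zero d hℓf)

omit hp [CharP K p] in
/-- **The straightened state keeps `e_G`** (in the band): its residual vertex has the dimension of `resVertex s`
(FILE E part 1 (E4)). [folklore] -/
theorem finrank_resVertex_cleanTschState_straighten {s : State K} {o : ℕ} (ho : ordZero s.F = o) (hpo : ¬ p ∣ o)
    (hr0 : s.r f = 0) (hr : ∀ e ∈ s.F.support, s.r ≤ e) (ℓ : Fin 4 → K) :
    Module.finrank K (ResCone.resVertex
        (⟨deletePthPowers p (tsch f (∑ i, C ((fun i => if i = f then (0 : K) else -(ℓ i / ℓ f)) i) * X i) s.F),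
          s.r, s.exc⟩ : State K)) = Module.finrank K (ResCone.resVertex s) :=
  finrank_resVertex_cleanTschState_linear p (straighten_coeff_self ℓ) hr0 hr ho hpo

end State

end FrameChange

end Summit.ResolutionOfSingularities.ResolutionOfSingularities.Theorems.PIDim4

end
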